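import Literature.Analysis.FunctionSpaces.TorusLiftDerivBounds
import Literature.Analysis.FunctionSpaces.TorusCalculusProofs
import Mathlib.Analysis.Calculus.SmoothSeries
import HarnessLib

/-!
# Term-by-term calculus for series of smooth functions on the flat torus

Analysis/FunctionSpaces support file (one predicate definition with proved API; no named facts). A family
`f : ι → T^d → F` of smooth functions has **summable lift bounds** (`Torus.SummableLiftBounds f`) if for
every order `n` the `n`-th derivatives of the periodic lifts are bounded uniformly on `ℝ^d` by a summable
family of constants. For such families the series `∑' i, f i` is smooth and every derivative passes
through the sum (Mathlib `contDiff_tsum`, `fderiv_tsum_apply`, transported to `Torus.partialDeriv`):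

* `Torus.SummableLiftBounds.isSmooth_tsum`, `.summable_apply`;
* `Torus.SummableLiftBounds.partialDeriv` — the family of partial derivatives again has summable lift
  bounds — and **`Torus.SummableLiftBounds.partialDeriv_tsum`**: `∂_l ∑' f i = ∑' ∂_l f i`;
* consequences: `laplacian_tsum`, `divergence_tsum`, `gradient_tsum` (`d = Fin 3` for the gradient, which
  the tree expresses through `BDSV.gradient_apply'`), closure under `apply_coord`, constant scalar weights
  (`const_smul`), sums (`add`), and the constructor `of_hasLiftDerivBounds` from the currency
  `Torus.HasLiftDerivBounds n (f i) (C n i) (L n i)` with `∑_i C n i · max 1 (L n i)ⁿ < ∞` (or directly from uniform bounds,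
  `of_norm_iteratedFDeriv_le`).

This is the series bookkeeping behind the term-by-term verification of the Navier–Stokes residual identity
for the Coiculescu–Palasek principal parts (`Literature.Analysis.FluidPDE.MikadoResidualIdentity`), whose
blocks obey exactly such bounds (`MikadoPrincipalParts`, `MikadoSpaceTime`).

## Mathlib / tree search

Mathlib: `contDiff_tsum`, `iteratedFDeriv_tsum_apply`, `fderiv_tsum_apply`, `ContinuousLinearMap.map_tsum`.
Tree: `Torus.partialDeriv_eq_fderiv_apply`, `Torus.fderiv_lift`, `Torus.lift_lineDeriv`,
`laplacian_eq_sum_partialDeriv_partialDeriv` (`TorusCalculus(Proofs)`), `Torus.HasLiftDerivBounds`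
(`TorusLiftDerivBounds`). `lean search 'partialDeriv_tsum|SummableLiftBounds'`: nothing prior.
-/

noncomputable section

open Set Function Filter
open scoped BigOperators ContDiff Topology

namespace Literature.Analysis.FunctionSpaces

namespace Torus

variable {d : Type*} [Fintype d] [DecidableEq d]
variable {F : Type*} [NormedAddCommGroup F] [NormedSpace ℝ F] [CompleteSpace F]
variable {ι : Type*}

/-- **Summable lift bounds**: every `f i` is smooth and, for every order `n`, the `n`-th derivatives of the
lifts are bounded uniformly by a summable family. [folklore] -/
def SummableLiftBounds (f : ι → UnitAddTorus d → F) : Prop :=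
  (∀ i, IsSmooth (f i)) ∧
    ∀ n : ℕ, ∃ C : ι → ℝ, Summable C ∧ ∀ (i : ι) (y : EuclideanSpace ℝ d), ‖iteratedFDeriv ℝ n (lift (f i)) y‖ ≤ C i

namespace SummableLiftBounds

variable {f g : ι → UnitAddTorus d → F}

omit [DecidableEq d] [CompleteSpace F] in
/-- Each term is smooth. [folklore] -/
theorem isSmooth (h : SummableLiftBounds f) (i : ι) : IsSmooth (f i) := h.1 i

omit [DecidableEq d] [CompleteSpace F] in
/-- The bound of order `n`. [folklore] -/
theorem bound (h : SummableLiftBounds f) (n : ℕ) :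
    ∃ C : ι → ℝ, Summable C ∧ ∀ (i : ι) (y : EuclideanSpace ℝ d), ‖iteratedFDeriv ℝ n (lift (f i)) y‖ ≤ C i := h.2 n

omit [DecidableEq d] [CompleteSpace F] in
/-- Pointwise norm bounds by a summable family. [folklore] -/
theorem norm_le (h : SummableLiftBounds f) : ∃ C : ι → ℝ, Summable C ∧ ∀ (i : ι) (x : UnitAddTorus d), ‖f i x‖ ≤ C i := by
  obtain ⟨C, hC, hb⟩ := h.bound 0
  refine ⟨C, hC, fun i x => ?_⟩
  obtain ⟨y, rfl⟩ := proj_surjective x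
  have h0 := hb i y
  rwa [norm_iteratedFDeriv_zero, lift_apply] at h0

omit [DecidableEq d] in
/-- **The series is pointwise (absolutely) summable.** [folklore] -/
theorem summable_apply (h : SummableLiftBounds f) (x : UnitAddTorus d) : Summable fun i => f i x := by
  obtain ⟨C, hC, hb⟩ := h.norm_le
  exact Summable.of_norm_bounded hC fun i => hb i x

omit [DecidableEq d] in
/-- **The series is smooth** (Mathlib `contDiff_tsum`). [folklore] -/
theorem isSmooth_tsum (h : SummableLiftBounds f) : IsSmooth fun x => ∑' i, f i x := by
  choose C hC hb using h.bound
  show ContDiff ℝ ∞ (lift fun x => ∑' i, f i x)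
  have hl : lift (fun x => ∑' i, f i x) = fun y => ∑' i, lift (f i) y := rfl
  rw [hl]
  exact contDiff_tsum (N := (⊤ : ℕ∞)) (fun i => h.isSmooth i) (fun n _ => hC n) fun n i y _ => hb n i y

omit [DecidableEq d] in
/-- Iterated derivatives of the lifted series, term by term (Mathlib `iteratedFDeriv_tsum_apply`). [folklore] -/
theorem iteratedFDeriv_lift_tsum (h : SummableLiftBounds f) (n : ℕ) (y : EuclideanSpace ℝ d) :
    iteratedFDeriv ℝ n (lift fun x => ∑' i, f i x) y = ∑' i, iteratedFDeriv ℝ n (lift (f i)) y := by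
  choose C hC hb using h.bound
  have hl : lift (fun x => ∑' i, f i x) = fun y => ∑' i, lift (f i) y := rfl
  rw [hl]
  exact iteratedFDeriv_tsum_apply (N := (⊤ : ℕ∞)) (fun i => h.isSmooth i) (fun n _ => hC n) (fun n i y _ => hb n i y)
    (by exact_mod_cast le_top) y

omit [DecidableEq d] in
/-- **The series obeys the summed bounds**: `‖Dⁿ(lift ∑' f i)‖ ≤ ∑ C n i`. [folklore] -/
theorem norm_iteratedFDeriv_lift_tsum_le (h : SummableLiftBounds f) {n : ℕ} {C : ι → ℝ} (hC : Summable C)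
    (hb : ∀ (i : ι) (y : EuclideanSpace ℝ d), ‖iteratedFDeriv ℝ n (lift (f i)) y‖ ≤ C i) (y : EuclideanSpace ℝ d) :
    ‖iteratedFDeriv ℝ n (lift fun x => ∑' i, f i x) y‖ ≤ ∑' i, C i := by
  rw [h.iteratedFDeriv_lift_tsum n y]
  exact tsum_of_norm_bounded hC.hasSum fun i => hb i y

/-! ### Closure properties -/

omit [CompleteSpace F] in
/-- **Partial derivatives of the family again have summable lift bounds** (one order is shifted:
`lift (∂_l f) = D(lift f)[e_l]`). [folklore] -/
theorem partialDeriv (h : SummableLiftBounds f) (l : d) : SummableLiftBounds fun i => Torus.partialDeriv l (f i) := by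
  refine ⟨fun i => (h.isSmooth i).partialDeriv l, fun n => ?_⟩
  obtain ⟨C, hC, hb⟩ := h.bound (n + 1)
  refine ⟨C, hC, fun i y => ?_⟩
  have h1 : IsContDiff 1 (f i) := (h.isSmooth i).isContDiff (by simp)
  have hl : lift (Torus.partialDeriv l (f i)) = fun y => _root_.fderiv ℝ (lift (f i)) y (EuclideanSpace.single l (1 : ℝ)) :=
    lift_lineDeriv h1 _
  rw [hl]
  have hD : ContDiff ℝ n (_root_.fderiv ℝ (lift (f i))) := (h.isSmooth i).fderiv_right (m := n) (by exact_mod_cast le_top)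
  calc ‖iteratedFDeriv ℝ n (fun y => _root_.fderiv ℝ (lift (f i)) y (EuclideanSpace.single l (1 : ℝ))) y‖
      ≤ ‖(EuclideanSpace.single l (1 : ℝ) : EuclideanSpace ℝ d)‖ * ‖iteratedFDeriv ℝ n (_root_.fderiv ℝ (lift (f i))) y‖ :=
        norm_iteratedFDeriv_clm_apply_const hD.contDiffAt (by exact_mod_cast le_rfl)
    _ = ‖iteratedFDeriv ℝ (n + 1) (lift (f i)) y‖ := by
          rw [show ‖(EuclideanSpace.single l (1 : ℝ) : EuclideanSpace ℝ d)‖ = 1 by simp, one_mul, norm_iteratedFDeriv_fderiv]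
    _ ≤ C i := hb i y

omit [DecidableEq d] [CompleteSpace F] in
/-- Post-composition with a continuous linear map. [folklore] -/
theorem clm_comp (h : SummableLiftBounds f) {G : Type*} [NormedAddCommGroup G] [NormedSpace ℝ G] (φ : F →L[ℝ] G) :
    SummableLiftBounds fun i x => φ (f i x) := by
  refine ⟨fun i => (h.isSmooth i).comp_clm φ, fun n => ?_⟩
  obtain ⟨C, hC, hb⟩ := h.bound n
  refine ⟨fun i => ‖φ‖ * C i, hC.mul_left _, fun i y => ?_⟩
  have hl : lift (fun x => φ (f i x)) = φ ∘ lift (f i) := rfl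
  rw [hl, φ.iteratedFDeriv_comp_left ((h.isSmooth i).contDiffAt) (by exact_mod_cast le_top)]
  exact (φ.norm_compContinuousMultilinearMap_le _).trans (mul_le_mul_of_nonneg_left (hb i y) (norm_nonneg _))

omit [DecidableEq d] [CompleteSpace F] in
/-- Constant scalar weights (bounded family of weights). [folklore] -/
theorem const_smul (h : SummableLiftBounds f) {c : ι → ℝ} {B : ℝ} (hc : ∀ i, |c i| ≤ B) :
    SummableLiftBounds fun i x => c i • f i x := by
  refine ⟨fun i => (h.isSmooth i).smul (c i), fun n => ?_⟩
  obtain ⟨C, hC, hb⟩ := h.bound n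
  have hC0 : ∀ i, 0 ≤ C i := fun i => (norm_nonneg _).trans (hb i 0)
  refine ⟨fun i => |c i| * C i, ?_, fun i y => ?_⟩
  · exact Summable.of_nonneg_of_le (fun i => mul_nonneg (abs_nonneg _) (hC0 i))
      (fun i => mul_le_mul_of_nonneg_right (hc i) (hC0 i)) (hC.mul_left B)
  · have hl : lift (fun x => c i • f i x) = c i • lift (f i) := rfl
    rw [hl, iteratedFDeriv_const_smul_apply ((h.isSmooth i).contDiffAt.of_le (by exact_mod_cast le_top)), norm_smul,
      Real.norm_eq_abs]
    exact mul_le_mul_of_nonneg_left (hb i y) (abs_nonneg _)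

omit [DecidableEq d] [CompleteSpace F] in
/-- Sums of two families. [folklore] -/
theorem add (hf : SummableLiftBounds f) (hg : SummableLiftBounds g) : SummableLiftBounds fun i x => f i x + g i x := by
  refine ⟨fun i => (hf.isSmooth i).add (hg.isSmooth i), fun n => ?_⟩
  obtain ⟨C, hC, hb⟩ := hf.bound n
  obtain ⟨D, hD, hb'⟩ := hg.bound n
  refine ⟨fun i => C i + D i, hC.add hD, fun i y => ?_⟩
  have hl : lift (fun x => f i x + g i x) = lift (f i) + lift (g i) := rfl
  rw [hl, iteratedFDeriv_add_apply ((hf.isSmooth i).contDiffAt.of_le (by exact_mod_cast le_top))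
    ((hg.isSmooth i).contDiffAt.of_le (by exact_mod_cast le_top))]
  exact (norm_add_le _ _).trans (add_le_add (hb i y) (hb' i y))

omit [DecidableEq d] [CompleteSpace F] in
/-- Finite sums of families. [folklore] -/
theorem finset_sum {κ : Type*} (s : Finset κ) {fam : κ → ι → UnitAddTorus d → F}
    (h : ∀ k ∈ s, SummableLiftBounds (fam k)) [Nonempty ι] (h0 : SummableLiftBounds fun (_ : ι) (_ : UnitAddTorus d) => (0 : F)) :
    SummableLiftBounds fun i x => ∑ k ∈ s, fam k i x := by
  classical
  induction s using Finset.induction_on with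
  | empty => simpa using h0
  | @insert a s ha ih =>
    have h1 := h a (Finset.mem_insert_self a s)
    have h2 := ih fun k hk => h k (Finset.mem_insert_of_mem hk)
    have := h1.add h2
    simpa [Finset.sum_insert ha] using this

omit [DecidableEq d] [CompleteSpace F] in
/-- The zero family has summable lift bounds whenever some summable positive family exists on `ι`
(e.g. `ι` countable); we give the version with an explicit summable witness. [folklore] -/
theorem zero {w : ι → ℝ} (hw : Summable w) (hw0 : ∀ i, 0 ≤ w i) :
    SummableLiftBounds fun (_ : ι) (_ : UnitAddTorus d) => (0 : F) := by
  refine ⟨fun _ => isSmooth_const (0 : F), fun n => ⟨w, hw, fun i y => ?_⟩⟩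
  have hl : lift (fun _ : UnitAddTorus d => (0 : F)) = fun _ => 0 := rfl
  rw [hl, iteratedFDeriv_fun_zero]
  simpa using hw0 i

omit [DecidableEq d] [CompleteSpace F] in
/-- **From the currency**: `HasLiftDerivBounds n (f i) (C n i) (L n i)` for all `n`, `i`, with `0 ≤ L n i` and
`∑_i C n i (max 1 (L n i))ⁿ < ∞` for every `n`. [folklore] -/
theorem of_hasLiftDerivBounds {C L : ℕ → ι → ℝ} (hf : ∀ n i, HasLiftDerivBounds n (f i) (C n i) (L n i))
    (hL : ∀ n i, 0 ≤ L n i) (hs : ∀ n, Summable fun i => C n i * max 1 (L n i) ^ n) : SummableLiftBounds f := by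
  refine ⟨fun i => (hf 0 i).isSmooth, fun n => ⟨fun i => C n i * max 1 (L n i) ^ n, hs n, fun i y => ?_⟩⟩
  refine ((hf n i).bound le_rfl y).trans ?_
  exact mul_le_mul_of_nonneg_left (pow_le_pow_left₀ (hL n i) (le_max_right _ _) n) (hf n i).nonneg

omit [DecidableEq d] [CompleteSpace F] in
/-- **From uniform bounds**: all derivatives of order `≤ n` of `lift (f i)` bounded by `B n i` with `∑_i B n i < ∞`. [folklore] -/
theorem of_norm_iteratedFDeriv_le (hf : ∀ i, IsSmooth (f i)) {B : ℕ → ι → ℝ} (hs : ∀ n, Summable (B n))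
    (hb : ∀ n i (y : EuclideanSpace ℝ d), ‖iteratedFDeriv ℝ n (lift (f i)) y‖ ≤ B n i) : SummableLiftBounds f :=
  ⟨hf, fun n => ⟨B n, hs n, hb n⟩⟩

/-! ### Derivatives through the sum -/

/-- **`∂_l ∑' f i = ∑' ∂_l f i`** (Mathlib `fderiv_tsum_apply` on the lifts). [folklore] -/
theorem partialDeriv_tsum (h : SummableLiftBounds f) (l : d) :
    Torus.partialDeriv l (fun x => ∑' i, f i x) = fun x => ∑' i, Torus.partialDeriv l (f i) x := by
  obtain ⟨C, hC, hb⟩ := h.bound 1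
  have hsm := h.isSmooth_tsum
  have hdiff : ∀ i, Differentiable ℝ (lift (f i)) := fun i =>
    ((h.isSmooth i).isContDiff (n := 1) (by simp)).differentiable (by simp)
  have hbound : ∀ i y, ‖_root_.fderiv ℝ (lift (f i)) y‖ ≤ C i := by
    intro i y
    rw [← norm_iteratedFDeriv_zero (𝕜 := ℝ) (f := _root_.fderiv ℝ (lift (f i))) (x := y), norm_iteratedFDeriv_fderiv]
    exact hb i y
  funext x
  obtain ⟨y, rfl⟩ := proj_surjective x
  have hf0 : Summable fun i => lift (f i) y := h.summable_apply (proj y)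
  have hder : _root_.fderiv ℝ (fun y => ∑' i, lift (f i) y) y = ∑' i, _root_.fderiv ℝ (lift (f i)) y :=
    fderiv_tsum_apply hC hdiff hbound hf0 y
  have hsumd : Summable fun i => _root_.fderiv ℝ (lift (f i)) y := Summable.of_norm_bounded hC fun i => hbound i y
  rw [partialDeriv_eq_fderiv_apply (hsm.isContDiff (by simp)), ← fderiv_lift,
    show lift (fun x => ∑' i, f i x) = fun y => ∑' i, lift (f i) y from rfl, hder]
  have happ := (ContinuousLinearMap.apply ℝ F (EuclideanSpace.single l (1 : ℝ))).map_tsum hsumd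
  simp only [ContinuousLinearMap.apply_apply] at happ
  rw [happ]
  refine tsum_congr fun i => ?_
  rw [partialDeriv_eq_fderiv_apply ((h.isSmooth i).isContDiff (by simp)), ← fderiv_lift]

/-- Pointwise form of `partialDeriv_tsum`. [folklore] -/
theorem partialDeriv_tsum_apply (h : SummableLiftBounds f) (l : d) (x : UnitAddTorus d) :
    Torus.partialDeriv l (fun x => ∑' i, f i x) x = ∑' i, Torus.partialDeriv l (f i) x :=
  congrFun (h.partialDeriv_tsum l) x

/-- **`Δ ∑' f i = ∑' Δ f i`.** [folklore] -/
theorem laplacian_tsum_apply (h : SummableLiftBounds f) (x : UnitAddTorus d) :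
    Torus.laplacian (fun x => ∑' i, f i x) x = ∑' i, Torus.laplacian (f i) x := by
  rw [laplacian_eq_sum_partialDeriv_partialDeriv h.isSmooth_tsum]
  have h2 : ∀ m, Torus.partialDeriv m (Torus.partialDeriv m fun x => ∑' i, f i x) x =
      ∑' i, Torus.partialDeriv m (Torus.partialDeriv m (f i)) x := by
    intro m
    rw [h.partialDeriv_tsum m, (h.partialDeriv m).partialDeriv_tsum_apply m x]
  simp only [h2]
  rw [← Summable.tsum_finsetSum (fun m _ => ((h.partialDeriv m).partialDeriv m).summable_apply x)]
  exact tsum_congr fun i => (laplacian_eq_sum_partialDeriv_partialDeriv (h.isSmooth i) x).symm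

end SummableLiftBounds

/-- **`div ∑' u i = ∑' div u i`** for vector fields with summable lift bounds. [folklore] -/
theorem SummableLiftBounds.divergence_tsum_apply {u : ι → UnitAddTorus d → EuclideanSpace ℝ d}
    (h : SummableLiftBounds u) (x : UnitAddTorus d) :
    Torus.divergence (fun x => ∑' i, u i x) x = ∑' i, Torus.divergence (u i) x := by
  unfold Torus.divergence
  have hco : ∀ m, (fun y => (∑' i, u i y) m) = fun y => ∑' i, u i y m := by
    intro m; funext y
    exact ((EuclideanSpace.proj m : EuclideanSpace ℝ d →L[ℝ] ℝ).map_tsum (h.summable_apply y))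
  have hm : ∀ m, SummableLiftBounds fun i y => u i y m := fun m => h.clm_comp (EuclideanSpace.proj m)
  simp only [hco, fun m => (hm m).partialDeriv_tsum_apply m x]
  rw [← Summable.tsum_finsetSum (fun m _ => ((hm m).partialDeriv m).summable_apply x)]

end Torus

end Literature.Analysis.FunctionSpaces
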